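import Summits.QuantumFields.YangMills.Theorems.BalabanUVNodesN09BackgroundRadiiTransferRestrict
import Summits.QuantumFields.YangMills.Theorems.BalabanUVNodesN09AtRecord13SepCoPHFluctNesting

/-!
# NODE N09 AT THE STAGE-13 v1.7 `SepCoPH` RECORD — THE HEREDITARY CLAUSE «HERED» OF THE CRITICAL CONFIGURATION (2.3) AT THE BARE-CHOICE RECORD HOLDS MODULO A FINE
# LEVEL-`j` GAUGE TRANSFORMATION (from [B11] Thm 1's three binders at the background radius + the (8)-membership clause, across the record's two radii), and
# EXACTLY as soon as both sides are in the block axial gauge — dag-n09-w3's displayed binder `hher` of `…FluctNesting` reduced to HIERARCHICAL AXIALITY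

TRACK A (YM-PLAN §2d, node N09 of 28), seat `pub-ymgap-dag-n09-w1` (D-0149 width seat 1∕4, generation 2), FILE 4 (`--supports` K1⁷ stmt-QuantumFields-20542 as a helper) over this seat's
FILES 1–2 (`…N09BackgroundRadiiTransfer` p594365, `…N09BackgroundRadiiTransferRestrict` p595440), n09-w2 g2's `…N09AxialCovariance181` (block axial gauge of the fine group:
`AxialGauge cd`, `gaugeAct_eq_self_of_fine_of_axialGauge`) and dag-n09-w3's `…N09AtRecord13SepCoPHFluctNesting` (p583971: the HERED chain, §4).  [I] = [Balaban1987RG1] (CMP 109), [B11] = [Balaban1985Variational] (CMP 102).  THEOREMS ONLY (0 `def`, 0 `sorry`).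

WHY.  dag-n09-w3's `BalabanUVNodesN09AtRecord13SepCoPHFluctNesting` (p583971) reduces N09's nesting binder (F7b) to (F7a) + the HEREDITARY CLAUSE
`hher : ∀ k ≤ K, ∀ V ∈ dom k, ∀ j < k, critCfgOfRecord ν K j (Ū^{j+1}(U_k V)) = Ū^j(U_k V)` («the critical configuration (2.3) over the average of a background IS the background's
partial average» — print's property of the AXIAL-gauge minimiser, [I] (2.3) p. 265 ∕ [B11] (1.1); w3: «NOT derivable for the bare-choice `Uk` of record», «def-R species»).  Two
features of the record make it non-trivial: (i) the two sides read NODE 00's (0.21) problem at TWO RADII — `critCfgOfRecord ν K j W = M^j(Uk K (j+1) ν.εreg W)` at the cut-off's radius,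
`U_k V = Uk K k εbg V` at the background radius (FILES 1–2 move [B11]'s clauses between them); (ii) both minimisers are BARE CHOICES.  THIS FILE proves what the record DOES give:
* §1 ★ `orbitRel_Uk_UkSucc_iter_of_thm1_εbg_of_reg8` — the MIXED-RADII `HOrbit`: for `V ∈ domAlt_k`, `j < k ≤ K`, the level-`(j+1)` minimiser of record AT RADIUS `εreg` over
  `Ū^{j+1}(U_k^{(εbg)} V)` lies in the level-`(j+1)` RESIDUAL ORBIT of `U_k^{(εbg)} V` — from `h11 ∕ hres ∕ huniq` at `εbg`, the level-`k` (8)-membership clause `hreg8`, `0 ≤ εreg ≤ εbg`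
  (FILE 2's transport: `U_k^{(εbg)}V` is itself an `εreg`-regular level-`(j+1)` minimiser over its average, so uniqueness moves down the radius with it as witness).
* §2 ★★ `hered_mod_fine_of_thm1_εbg_of_reg8` — HERED MODULO A FINE TRANSFORMATION: `critCfgOfRecord ν K j (Ū^{j+1}(U_k V)) = (Ū^j(U_k V))^s` for SOME level-`j` gauge transformation `s`
  with `s = 1` at the block centres `emb y` (`s = r↾T^{(j)}` for the residual `r` of §1; r13's `iter_gaugeAct`) — the EXACT obstruction: a fine `s`, invisible to the average
  (`M(V^s) = M(V)`) but NOT to the bondwise fluctuation variables of (2.9).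
* §3 ★★ `hered_of_axial_of_thm1_εbg_of_reg8` — HERED EXACTLY when BOTH sides are block-axial for a contour system `cd` (n09-w2 g2's `gaugeAct_eq_self_of_fine_of_axialGauge`: the axial
  image in a fine orbit is unique); hence ★★★ `hher_of_hierAxial_of_thm1_εbg_of_reg8`: dag-n09-w3's binder `hher` VERBATIM (at `dom := domAltOfRecord ν K`, `ε := εbg`) from the [B11] ×3
  package at `εbg` + `hreg8` + `0 ≤ εreg ≤ εbg` + HIERARCHICAL AXIALITY «`Ū^j(U_k V)` is `cd j`-axial for every `j < k`» + n09-w2 g2's convention «`critCfgOfRecord` is `cd j`-axial on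
  the solvable set» (its `hax`).  LOCATED READING: at the bare-choice record neither axiality holds by design; after the one-token re-points on the table (w2 g2: `critCfgOfRecord := ax ∘ …`;
  def-R∕def-T: `Uk :=` a hierarchically axial selection) BOTH are definitional and HERED becomes a theorem from [B11] Thm 1 alone — this file is the kernel certificate of that sentence.
* §4 along dag-n09-w3's chain (`…FluctNesting`, generic `dom ∕ ε`): `chiβ13_iterUk_eq_one_of_hierAxial_of_reg8` ((N29) «`χ^{(2.9)}_j(Ū^j(U_k V)) = 1`») and ★★
  `iterUk_mem_regSet_of_supp_of_hierAxial_of_reg8` — the `regSet` half of the OnDomains doors' nesting binder `hnestreg` from (F7a) + the inputs above (the `domAlt` half =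
  [B7] Prop. 1-type averaging regularity, NOT supplied).

HONEST FRAMING: count-neutral kernel gauge∕order bookkeeping over NODE 00's definitions of record; NOTHING of Bałaban's asserted ([B11] Thm 1's clauses and the two axiality
conventions are DISPLAYED hypotheses); NO carrier re-pointed; HERED NOT claimed at the bare-choice record; N09 NOT discharged; K0⁷ ∕ K1⁷ NOT closed; counts unmoved (typed 28∕28 ·
discharged 5∕27); one finite four-torus programme at fixed ε — R4 closes the conditional rung `BalabanLadder.UV` only; the Yang–Mills mass gap (Clay) is NOT proved by any of this; nothing
continuum ∕ ℝ⁴ ∕ OS.  THEOREMS ONLY, standard axioms.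
-/

noncomputable section

namespace Summit.QuantumFields.YangMills.BalabanUVNodes.N09HeredModFineOfThm1

open Literature.MathematicalPhysics.QuantumFieldTheory.Balaban1983to89
open Literature.MathematicalPhysics.QuantumFieldTheory.Balaban1983to89.T4Continuum (T4Family)
open Literature.MathematicalPhysics.QuantumFieldTheory.Balaban1983to89.Node00
open Literature.MathematicalPhysics.QuantumFieldTheory.Balaban1983to89.B12GaugeOrbits021 (OrbitRel IsResidual)
open Literature.MathematicalPhysics.QuantumFieldTheory.Balaban1983to89.B16Sect1Backgrounds (toMS iter_gaugeAct)
open Literature.MathematicalPhysics.QuantumFieldTheory.Balaban1983to89.GaugeField (gaugeAct)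
open Summit.QuantumFields.YangMills.BalabanUVNodes.N09BackgroundRadiiTransfer
open Summit.QuantumFields.YangMills.BalabanUVNodes.N09BackgroundRadiiTransferRestrict (bgReg_anti_level succ_le_range_of_le_of_lt)
open Summit.QuantumFields.YangMills.BalabanUVNodes.N09AxialCovariance181 (gaugeAct_eq_self_of_fine_of_axialGauge)
open Summit.QuantumFields.YangMills.BalabanUVNodes.N09AtRecord13SepCoPHFluctNesting (iterUk_mem_regSet_of_supp_of_critCfg_hered chiβ13_iterUk_eq_one_of_critCfg_hered)

variable {F : T4Family} {N : ℕ} [NeZero N]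

/-! ## §1. The mixed-radii `HOrbit`: the (2.3)-minimiser over the average of the background lies in the background's residual orbit -/

/-- ★ **MIXED-RADII `HOrbit`**: for `V ∈ domAlt_k`, `j < k ≤ K`: `OrbitRel (j+1) (U_k^{(εbg)} V) (Uk K (j+1) ν.εreg (Ū^{j+1}(U_k^{(εbg)} V)))` — the level-`(j+1)` minimiser OF RECORD at
the cut-off's radius over the background's `(j+1)`-average is a residual-`(j+1)` gauge transform of the background.  From: `hres` (the background restricts at radius `εbg`),
`hreg8` + `0 ≤ εreg` (it is `εreg`-regular at level `k`, hence at level `j+1`: FILE 2 `bgReg_anti_level`) ⇒ it minimises at radius `εreg` too and witnesses FILE 1's uniqueness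
transfer of `huniq` down to `εreg`; then uniqueness pairs it with the bare choice `Uk K (j+1) ν.εreg (·)`.  (`h11`'s existence half and `hle` are not even needed here.)
[cite: Balaban1985Variational, Thm 1 (6) and (8) p.279; Balaban1987RG1, (1.1)–(1.2) p.260 and (2.3) p.265] -/
theorem orbitRel_Uk_UkSucc_iter_of_thm1_εbg_of_reg8 (ν : Stage7Numerics) (εbg : ℝ) (K : ℕ)
    (hres : ∀ k, k ≤ K → HRestrict F N εbg K k (domAltOfRecord F N ν K k))
    (huniq : ∀ k, k ≤ K → ∀ V ∈ domAltOfRecord F N ν K k, ∀ j < k,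
      UniqueUkOrbit F N K (j + 1) εbg (Averaging.iter (avOfRecord F N K) (j + 1) (Uk F N K k εbg V)))
    (hreg8 : ∀ k, k ≤ K → ∀ V ∈ domAltOfRecord F N ν K k, Uk F N K k εbg V ∈ bgReg F N K k ν.εreg) (hle : ν.εreg ≤ εbg) (hεreg : 0 ≤ ν.εreg) :
    ∀ k, k ≤ K → ∀ V ∈ domAltOfRecord F N ν K k, ∀ j < k,
      OrbitRel (j + 1) (Uk F N K k εbg V)
        (Uk F N K (j + 1) ν.εreg (Averaging.iter (avOfRecord F N K) (j + 1) (Uk F N K k εbg V))) := by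
  intro k hk V hV j hj
  have hB := hres k hk V hV j hj
  have hmem : Uk F N K k εbg V ∈ bgReg F N K (j + 1) ν.εreg := bgReg_anti_level (by omega) hεreg (hreg8 k hk V hV)
  have hBε := isBackground_of_le_of_mem hle hB hmem
  exact uniqueUkOrbit_of_le_of_isBackground_mem hle hB hmem (huniq k hk V hV j hj) _ _ hBε (isBackground_Uk ⟨_, hBε⟩)

/-! ## §2. HERED modulo a fine level-`j` gauge transformation -/

/-- ★★ **HERED MODULO A FINE TRANSFORMATION**: for `V ∈ domAlt_k`, `j < k ≤ K`, the critical configuration of record over the background's `(j+1)`-average is the background's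
`j`-average UP TO a level-`j` gauge transformation `s` trivial at the block centres: `critCfgOfRecord ν K j (Ū^{j+1}(U_k V)) = (Ū^j(U_k V))^s`, `s (emb y) = 1` (`s = r↾T^{(j)}` for the
residual `r` of §1, by `M^j(U^r) = (M^j U)^{r↾T^{(j)}}`).  This is the EXACT content the bare-choice record gives; `s = 1` is what HERED asks.
[cite: Balaban1987RG1, (2.3) p.265 and (1.1) p.260; Balaban1985Variational, Thm 1 (6) p.279; Balaban1985Averaging, (11) p.19] -/
theorem hered_mod_fine_of_thm1_εbg_of_reg8 (ν : Stage7Numerics) (εbg : ℝ) (K : ℕ)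
    (hres : ∀ k, k ≤ K → HRestrict F N εbg K k (domAltOfRecord F N ν K k))
    (huniq : ∀ k, k ≤ K → ∀ V ∈ domAltOfRecord F N ν K k, ∀ j < k,
      UniqueUkOrbit F N K (j + 1) εbg (Averaging.iter (avOfRecord F N K) (j + 1) (Uk F N K k εbg V)))
    (hreg8 : ∀ k, k ≤ K → ∀ V ∈ domAltOfRecord F N ν K k, Uk F N K k εbg V ∈ bgReg F N K k ν.εreg) (hle : ν.εreg ≤ εbg) (hεreg : 0 ≤ ν.εreg) :
    ∀ k, k ≤ K → ∀ V ∈ domAltOfRecord F N ν K k, ∀ j < k, ∃ s : GaugeTransf (F.P K) j (SU N), (∀ y : Site (F.P K) (j + 1), s (emb y) = 1) ∧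
      critCfgOfRecord F N ν K j (Averaging.iter (avOfRecord F N K) (j + 1) (Uk F N K k εbg V)) =
        gaugeAct s (Averaging.iter (avOfRecord F N K) j (Uk F N K k εbg V)) := by
  intro k hk V hV j hj
  obtain ⟨r, hr, hEq⟩ := orbitRel_Uk_UkSucc_iter_of_thm1_εbg_of_reg8 ν εbg K hres huniq hreg8 hle hεreg k hk V hV j hj
  have hj' : j ≤ (F.P K).m + (F.P K).K := (Nat.le_succ j).trans (succ_le_range_of_le_of_lt (F := F) hk hj)
  refine ⟨toMS r j, fun y => hr y, ?_⟩
  rw [critCfgOfRecord_def, hEq, iter_gaugeAct (avOfRecord F N K) r _ j hj']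

/-! ## §3. HERED exactly, from block axiality of both sides -/

/-- ★★ **HERED FROM AXIALITY OF BOTH SIDES**: if, for a contour system `cd` at level `j`, both the background's `j`-average `Ū^j(U_k V)` and the critical configuration of record over
`Ū^{j+1}(U_k V)` are in the block axial gauge `AxialGauge cd`, then they are EQUAL — §2's fine `s` relates two axial configurations, so it is `1` (n09-w2 g2's
`gaugeAct_eq_self_of_fine_of_axialGauge`). [cite: Balaban1987RG1, (2.2)–(2.3) p.265; Balaban1985RegularSpaces, (1.15) p.78; Balaban1985Variational, Thm 1 (6) p.279] -/
theorem hered_of_axial_of_thm1_εbg_of_reg8 (ν : Stage7Numerics) (εbg : ℝ) (K : ℕ)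
    (hres : ∀ k, k ≤ K → HRestrict F N εbg K k (domAltOfRecord F N ν K k))
    (huniq : ∀ k, k ≤ K → ∀ V ∈ domAltOfRecord F N ν K k, ∀ j < k,
      UniqueUkOrbit F N K (j + 1) εbg (Averaging.iter (avOfRecord F N K) (j + 1) (Uk F N K k εbg V)))
    (hreg8 : ∀ k, k ≤ K → ∀ V ∈ domAltOfRecord F N ν K k, Uk F N K k εbg V ∈ bgReg F N K k ν.εreg) (hle : ν.εreg ≤ εbg) (hεreg : 0 ≤ ν.εreg)
    {k : ℕ} (hk : k ≤ K) {V : GaugeField (F.P K) k (SU N)} (hV : V ∈ domAltOfRecord F N ν K k) {j : ℕ} (hj : j < k) (cd : ContourData (F.P K) j (SU N))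
    (haxbg : AxialGauge cd (Averaging.iter (avOfRecord F N K) j (Uk F N K k εbg V)))
    (haxcrit : AxialGauge cd (critCfgOfRecord F N ν K j (Averaging.iter (avOfRecord F N K) (j + 1) (Uk F N K k εbg V)))) :
    critCfgOfRecord F N ν K j (Averaging.iter (avOfRecord F N K) (j + 1) (Uk F N K k εbg V)) = Averaging.iter (avOfRecord F N K) j (Uk F N K k εbg V) := by
  obtain ⟨s, hs, hEq⟩ := hered_mod_fine_of_thm1_εbg_of_reg8 ν εbg K hres huniq hreg8 hle hεreg k hk V hV j hj
  rw [hEq] at haxcrit ⊢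
  exact gaugeAct_eq_self_of_fine_of_axialGauge cd haxbg hs haxcrit

/-- ★★★ **dag-n09-w3's BINDER `hher` VERBATIM** (`…FluctNesting.chiβ13_iterUk_eq_one_of_critCfg_hered` ∕ `…_of_regSets_of_critCfg_hered`, at `dom := domAltOfRecord ν K`, `ε := εbg`)
**FROM THE [B11] ×3 PACKAGE AT `εbg`, THE (8)-MEMBERSHIP CLAUSE, `0 ≤ εreg ≤ εbg`, AND HIERARCHICAL AXIALITY**: if for contour systems `cd j` (e.g. node00-def-B's
`contourOfRecord F N K j`) every partial average `Ū^j(U_k V)` of the background of a small field is `cd j`-axial (the background is chosen in the HIERARCHICAL axial gauge — def-R∕def-T's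
re-point) and the record's critical configuration is `cd j`-axial over those averages (n09-w2 g2's convention `hax` on the solvable set), then HERED holds.  CONDITIONAL on every displayed
hypothesis; at the bare-choice record the two axialities FAIL by design (located, not a defect of print). [cite: Balaban1987RG1, (2.3) p.265, (1.1)–(1.2) p.260; Balaban1985Variational, Thm 1 (6) and (8) p.279; Balaban1985RegularSpaces, (1.15) p.78] -/
theorem hher_of_hierAxial_of_thm1_εbg_of_reg8 (ν : Stage7Numerics) (εbg : ℝ) (K : ℕ) (cd : (j : ℕ) → ContourData (F.P K) j (SU N))
    (hres : ∀ k, k ≤ K → HRestrict F N εbg K k (domAltOfRecord F N ν K k))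
    (huniq : ∀ k, k ≤ K → ∀ V ∈ domAltOfRecord F N ν K k, ∀ j < k,
      UniqueUkOrbit F N K (j + 1) εbg (Averaging.iter (avOfRecord F N K) (j + 1) (Uk F N K k εbg V)))
    (hreg8 : ∀ k, k ≤ K → ∀ V ∈ domAltOfRecord F N ν K k, Uk F N K k εbg V ∈ bgReg F N K k ν.εreg) (hle : ν.εreg ≤ εbg) (hεreg : 0 ≤ ν.εreg)
    (haxbg : ∀ k, k ≤ K → ∀ V ∈ domAltOfRecord F N ν K k, ∀ j < k, AxialGauge (cd j) (Averaging.iter (avOfRecord F N K) j (Uk F N K k εbg V)))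
    (haxcrit : ∀ k, k ≤ K → ∀ V ∈ domAltOfRecord F N ν K k, ∀ j < k,
      AxialGauge (cd j) (critCfgOfRecord F N ν K j (Averaging.iter (avOfRecord F N K) (j + 1) (Uk F N K k εbg V)))) :
    ∀ k, k ≤ K → ∀ V ∈ domAltOfRecord F N ν K k, ∀ j < k,
      critCfgOfRecord F N ν K j (Averaging.iter (avOfRecord F N K) (j + 1) (Uk F N K k εbg V)) = Averaging.iter (avOfRecord F N K) j (Uk F N K k εbg V) :=
  fun k hk V hV j hj => hered_of_axial_of_thm1_εbg_of_reg8 ν εbg K hres huniq hreg8 hle hεreg hk hV hj (cd j) (haxbg k hk V hV j hj) (haxcrit k hk V hV j hj)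

/-- **THE `haxcrit` INPUT IS n09-w2 g2's `hax` RESTRICTED**: axiality of the record's critical configuration «on the solvable set at radius `εreg`» (the shape of
`…N09AxialCovariance181.thm3Member_stage13SepCoPH_of_stepsOnLoc_of_axialOn`'s `hax`) gives it over the averages `Ū^{j+1}(U_k V)` of small fields, which ARE solvable at `εreg`
(§1's witness). [cite: Balaban1987RG1, (2.3) p.265 (bookkeeping)] -/
theorem haxcrit_of_hax_solvable (ν : Stage7Numerics) (εbg : ℝ) (K : ℕ) (cd : (j : ℕ) → ContourData (F.P K) j (SU N))
    (hres : ∀ k, k ≤ K → HRestrict F N εbg K k (domAltOfRecord F N ν K k))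
    (hreg8 : ∀ k, k ≤ K → ∀ V ∈ domAltOfRecord F N ν K k, Uk F N K k εbg V ∈ bgReg F N K k ν.εreg) (hle : ν.εreg ≤ εbg) (hεreg : 0 ≤ ν.εreg)
    (hax : ∀ j < K, ∀ W : GaugeField (F.P K) (j + 1) (SU N), UkExists F N K (j + 1) ν.εreg W → AxialGauge (cd j) (critCfgOfRecord F N ν K j W)) :
    ∀ k, k ≤ K → ∀ V ∈ domAltOfRecord F N ν K k, ∀ j < k,
      AxialGauge (cd j) (critCfgOfRecord F N ν K j (Averaging.iter (avOfRecord F N K) (j + 1) (Uk F N K k εbg V))) := by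
  intro k hk V hV j hj
  refine hax j (by omega) _ ⟨Uk F N K k εbg V, ?_⟩
  exact isBackground_of_le_of_mem hle (hres k hk V hV j hj) (bgReg_anti_level (by omega) hεreg (hreg8 k hk V hV))


/-! ## §4. Consequences along dag-n09-w3's chain: (N29) and the regular-set half of the nesting binder (F7b) from hierarchical axiality -/

/-- **(N29) FROM HIERARCHICAL AXIALITY**: under §3's inputs (at a Stage-13 parameter `θ₀`, radius letters `θ₀.ν.εreg ≤ εbg`) and `0 < θ₀.ε₂₉`, the β-slot cut-off is `1` at every
partial average of the background of a small field: `χ^{(2.9)}_j(Ū^j(U_k V)) = 1` (dag-n09-w3's `chiβ13_iterUk_eq_one_of_critCfg_hered` fed by `hher_of_hierAxial_of_thm1_εbg_of_reg8`).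
[cite: Balaban1987RG1, (2.3) p.265 and (2.9) p.266; Balaban1985Variational, Thm 1 (6) and (8) p.279] -/
theorem chiβ13_iterUk_eq_one_of_hierAxial_of_reg8 (θ₀ : Stage13Params F N) (hε : 0 < θ₀.ε₂₉) (P : B12.RunParams) (εbg : ℝ)
    (cd : (j : ℕ) → ContourData (F.P P.K) j (SU N))
    (hres : ∀ k, k ≤ P.K → HRestrict F N εbg P.K k (domAltOfRecord F N θ₀.ν P.K k))
    (huniq : ∀ k, k ≤ P.K → ∀ V ∈ domAltOfRecord F N θ₀.ν P.K k, ∀ j < k,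
      UniqueUkOrbit F N P.K (j + 1) εbg (Averaging.iter (avOfRecord F N P.K) (j + 1) (Uk F N P.K k εbg V)))
    (hreg8 : ∀ k, k ≤ P.K → ∀ V ∈ domAltOfRecord F N θ₀.ν P.K k, Uk F N P.K k εbg V ∈ bgReg F N P.K k θ₀.ν.εreg) (hle : θ₀.ν.εreg ≤ εbg) (hεreg : 0 ≤ θ₀.ν.εreg)
    (haxbg : ∀ k, k ≤ P.K → ∀ V ∈ domAltOfRecord F N θ₀.ν P.K k, ∀ j < k, AxialGauge (cd j) (Averaging.iter (avOfRecord F N P.K) j (Uk F N P.K k εbg V)))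
    (haxcrit : ∀ k, k ≤ P.K → ∀ V ∈ domAltOfRecord F N θ₀.ν P.K k, ∀ j < k,
      AxialGauge (cd j) (critCfgOfRecord F N θ₀.ν P.K j (Averaging.iter (avOfRecord F N P.K) (j + 1) (Uk F N P.K k εbg V)))) :
    ∀ k, k ≤ P.K → ∀ V ∈ domAltOfRecord F N θ₀.ν P.K k, ∀ j < k,
      chiβOfRecord₁₃ F N θ₀ P.K (gOfRecord₁₃ F N θ₀ P) j (Averaging.iter (avOfRecord F N P.K) j (Uk F N P.K k εbg V)) = 1 :=
  chiβ13_iterUk_eq_one_of_critCfg_hered θ₀ hε P (hher_of_hierAxial_of_thm1_εbg_of_reg8 θ₀.ν εbg P.K cd hres huniq hreg8 hle hεreg haxbg haxcrit)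

/-- ★★ **THE REGULAR-SET HALF OF N09's NESTING BINDER (F7b) FROM (F7a) + HIERARCHICAL AXIALITY** (dag-n09-w3's `iterUk_mem_regSet_of_supp_of_critCfg_hered` with its `hher` supplied by §3):
under the global support binder (F7a) `hχreg`, `0 < θ₀.ε₂₉`, the [B11] binders `hres ∕ huniq` at `εbg`, the (8)-membership clause, `0 ≤ εreg ≤ εbg` and the two axialities,
`Ū^{i+1}(U_k V) ∈ regSetOfRecord K i ρ_i` for every small field `V ∈ domAlt_k`, `i + 1 < k ≤ P.K` — the `regSet` half of the OnDomains doors' `hnestreg` (the `domAlt_{i+1}` half is the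
averaging-regularity statement «averages of a regular background are small fields», [B7] Prop. 1 — NOT supplied here). [cite: Balaban1987RG1, (2.1)–(2.3) p.265, (2.9)–(2.10) pp.266–267, p.256 l.6; Balaban1985Variational, Thm 1 (6) and (8) p.279] -/
theorem iterUk_mem_regSet_of_supp_of_hierAxial_of_reg8 (θ₀ : Stage13Params F N) (hε : 0 < θ₀.ε₂₉) (P : B12.RunParams) (εbg : ℝ)
    (cd : (j : ℕ) → ContourData (F.P P.K) j (SU N))
    (hχreg : ∀ i, i + 1 < P.K → ∀ U, U ∉ regSetOfRecord F N P.K i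
        (betaInputOfRecord F N (TβOfRecord₁₃ F N) (chiβOfRecord₁₃ F N θ₀) P.K (gOfRecord₁₃ F N θ₀ P) i) →
      chiβOfRecord₁₃ F N θ₀ P.K (gOfRecord₁₃ F N θ₀ P) (i + 1) U = 0)
    (hres : ∀ k, k ≤ P.K → HRestrict F N εbg P.K k (domAltOfRecord F N θ₀.ν P.K k))
    (huniq : ∀ k, k ≤ P.K → ∀ V ∈ domAltOfRecord F N θ₀.ν P.K k, ∀ j < k,
      UniqueUkOrbit F N P.K (j + 1) εbg (Averaging.iter (avOfRecord F N P.K) (j + 1) (Uk F N P.K k εbg V)))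
    (hreg8 : ∀ k, k ≤ P.K → ∀ V ∈ domAltOfRecord F N θ₀.ν P.K k, Uk F N P.K k εbg V ∈ bgReg F N P.K k θ₀.ν.εreg) (hle : θ₀.ν.εreg ≤ εbg) (hεreg : 0 ≤ θ₀.ν.εreg)
    (haxbg : ∀ k, k ≤ P.K → ∀ V ∈ domAltOfRecord F N θ₀.ν P.K k, ∀ j < k, AxialGauge (cd j) (Averaging.iter (avOfRecord F N P.K) j (Uk F N P.K k εbg V)))
    (haxcrit : ∀ k, k ≤ P.K → ∀ V ∈ domAltOfRecord F N θ₀.ν P.K k, ∀ j < k,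
      AxialGauge (cd j) (critCfgOfRecord F N θ₀.ν P.K j (Averaging.iter (avOfRecord F N P.K) (j + 1) (Uk F N P.K k εbg V)))) :
    ∀ k, k ≤ P.K → ∀ V ∈ domAltOfRecord F N θ₀.ν P.K k, ∀ i, i + 1 < k →
      Averaging.iter (avOfRecord F N P.K) (i + 1) (Uk F N P.K k εbg V) ∈ regSetOfRecord F N P.K i
        (betaInputOfRecord F N (TβOfRecord₁₃ F N) (chiβOfRecord₁₃ F N θ₀) P.K (gOfRecord₁₃ F N θ₀ P) i) :=
  iterUk_mem_regSet_of_supp_of_critCfg_hered θ₀ hε P hχreg (hher_of_hierAxial_of_thm1_εbg_of_reg8 θ₀.ν εbg P.K cd hres huniq hreg8 hle hεreg haxbg haxcrit)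

end Summit.QuantumFields.YangMills.BalabanUVNodes.N09HeredModFineOfThm1

end
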